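import Mathlib.Analysis.SpecialFunctions.Pow.Deriv
import Literature.Geometry.Lorentzian.CurvatureRegularity
import HarnessLib

/-!
# A positive conformal factor between smooth metrics is smooth

If `g, g'` are smooth pseudo-Riemannian metrics on the same manifold, `g` Riemannian, and
`g'(v, w) = φ(x)⁴ g(v, w)` with `φ > 0`, then `φ` is `C^∞`: near every point, for a vector `s(x)`
of the smooth local frame of the tangent bundle, `φ⁴ = g'(s, s)/g(s, s)` with `g(s, s) > 0`
smooth (`contMDiffOn_gram_localFrame`), and `t ↦ t^{1/4}` is smooth on `(0, ∞)`.

This regularity is implicit whenever Schoen–Yau (Comm. Math. Phys. 65 (1979), Lemma 3.3 and the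
proof of Thm. 2, pp. 71–74) pass between a scalar-flat conformal metric `φ⁴ ds²` and the equation
`Δφ = Rφ/8` for its factor: in this tree the conformal scalar-curvature law
(`conformal_scalarCurvature_law`) needs `φ ∈ C^∞`, while the elliptic steps of
`RicciVariationEllipticSteps.lean` only record the metrics. Main result:
`PseudoRiemannianMetric.contMDiff_conformalFactor`. Everything is proved; no definitions, no
named facts.

## References

* R. Schoen, S.-T. Yau, Comm. Math. Phys. 65 (1979) 45–76, Lemma 3.3 (pp. 71–72).
-/

noncomputable section

open Bundle Set Function Filter Manifold
open scoped Manifold ContDiff Topology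

namespace Literature.Geometry.Lorentzian

namespace PseudoRiemannianMetric

variable {E : Type*} [NormedAddCommGroup E] [NormedSpace ℝ E] {H : Type*} [TopologicalSpace H]
  {I : ModelWithCorners ℝ E H} {M : Type*} [TopologicalSpace M] [ChartedSpace H M]
  [IsManifold I ∞ M]

/-- **A positive conformal factor between smooth metrics is smooth**: if `g` is Riemannian,
`g'(v, w) = φ(x)⁴ g(v, w)` for all `x, v, w`, and `φ > 0`, then `φ ∈ C^∞(M)` (on a manifold of
positive dimension; `φ⁴ = g'(s,s)/g(s,s)` for a local frame vector `s`, and `t ↦ t^{1/4}` is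
smooth on `(0, ∞)`). [cite: SchoenYauPMT1979, Lemma 3.3 (pp. 71–72)] -/
theorem contMDiff_conformalFactor [Nontrivial E]
    (g g' : PseudoRiemannianMetric I ∞ E (TangentSpace I : M → Type _)) (hg : g.IsRiemannian)
    {φ : M → ℝ} (hpos : ∀ x, 0 < φ x)
    (hconf : ∀ (x : M) (v w : TangentSpace I x), g'.val x v w = φ x ^ 4 * g.val x v w) :
    ContMDiff I 𝓘(ℝ, ℝ) ∞ φ := by
  classical
  intro x₀
  -- a smooth local frame vector near `x₀`
  set bE : Module.Basis (Module.Basis.ofVectorSpaceIndex ℝ E) ℝ E := Module.Basis.ofVectorSpace ℝ E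
    with hbE
  obtain ⟨i₀⟩ : Nonempty (Module.Basis.ofVectorSpaceIndex ℝ E) := bE.index_nonempty
  set e := trivializationAt E (TangentSpace I : M → Type _) x₀ with he
  set s : (x : M) → TangentSpace I x := e.localFrame bE i₀ with hs
  have hx₀ : x₀ ∈ e.baseSet := by
    simp [he]
  -- `G = g(s,s)`, `G' = g'(s,s)` are smooth on the base set, `G > 0`
  have hG : CMDiff[e.baseSet] ∞ (fun x ↦ g.val x (s x) (s x)) := contMDiffOn_gram_localFrame e g bE i₀ i₀
  have hG' : CMDiff[e.baseSet] ∞ (fun x ↦ g'.val x (s x) (s x)) := contMDiffOn_gram_localFrame e g' bE i₀ i₀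
  have hspos : ∀ x ∈ e.baseSet, 0 < g.val x (s x) (s x) := by
    intro x hx
    refine hg x (s x) ?_
    rw [hs, e.localFrame_apply_of_mem_baseSet bE hx]
    exact (e.basisAt bE hx).ne_zero i₀
  -- `φ = (G'/G)^{1/4}` on the base set
  have hformula : ∀ x ∈ e.baseSet,
      φ x = (g'.val x (s x) (s x) / g.val x (s x) (s x)) ^ (1 / 4 : ℝ) := by
    intro x hx
    have hGx := hspos x hx
    rw [hconf x (s x) (s x), mul_div_assoc, div_self hGx.ne', mul_one,
      show (φ x ^ 4 : ℝ) = φ x ^ (4 : ℝ) by norm_cast, ← Real.rpow_mul (hpos x).le]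
    norm_num
  -- smoothness of the right-hand side at `x₀`
  have hnhds : e.baseSet ∈ 𝓝 x₀ := e.open_baseSet.mem_nhds hx₀
  have hq : ContMDiffAt I 𝓘(ℝ, ℝ) ∞ (fun x ↦ g'.val x (s x) (s x) / g.val x (s x) (s x)) x₀ :=
    ((hG' x₀ hx₀).contMDiffAt hnhds).div₀ ((hG x₀ hx₀).contMDiffAt hnhds) (hspos x₀ hx₀).ne'
  have hq0 : 0 < g'.val x₀ (s x₀) (s x₀) / g.val x₀ (s x₀) (s x₀) := by
    rw [hconf x₀ (s x₀) (s x₀), mul_div_assoc, div_self (hspos x₀ hx₀).ne', mul_one]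
    exact pow_pos (hpos x₀) 4
  have hr : ContDiffAt ℝ ∞ (fun t : ℝ ↦ t ^ (1 / 4 : ℝ)) (g'.val x₀ (s x₀) (s x₀) / g.val x₀ (s x₀) (s x₀)) :=
    Real.contDiffAt_rpow_const_of_ne hq0.ne'
  have hcomp := hr.comp_contMDiffAt (f := fun x ↦ g'.val x (s x) (s x) / g.val x (s x) (s x)) hq
  refine hcomp.congr_of_eventuallyEq ?_
  filter_upwards [hnhds] with x hx
  exact hformula x hx

end PseudoRiemannianMetric

end Literature.Geometry.Lorentzian

end
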